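import Summits.KontsevichZagierPeriods.KontsevichZagierPeriods.Theorems.FurushoPentagonKernelModuloPeriodConjectureEvalRowZDivFold

/-!
# Crux `LinRedNormalForm.HoffmanSpanInKZ` (stmt-KontsevichZagierPeriods-15044), line `eds-ds`:
# the linearised EDS rows vanish at every DOUBLE-SHUFFLE solution (E5′)

Line `eds-ds` (strategist's alternative line on the crux; lead c3): the canonical regularised
extended-double-shuffle family of Ihara–Kaneko–Zagier, whose realisation inside the KZ calculus is the
tree theorem `FurushoPentagon.DoubleShuffleInKZ`. The kernel-checkable rank engine
`Literature/…/LinEDS.lean` and its soundness chain on route FurushoPentagon (crux stmt-15058) prove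
the Hoffman-spanning leaf at every group-like solution of DRINFELD'S PENTAGON, the pentagon entering
ONLY through step E5 (`stub_eval_rowZ_divFold`: the integer EDS rows vanish at `φ`), via Furusho's
`NCSeries.DrinfeldPentagon.piY_mul_piY_eq_sum_stuffle`. This file proves the double-shuffle twin E5′:

* `piY_mul_piY_eq_sum_stuffle_of_gds` — for a series `φ` over a commutative `ℚ`-algebra satisfying
  Racinet's generalised double shuffle (`NCSeries.GeneralisedDoubleShuffle φ`: `φ_* = φ_corr · π_Y(φ)`
  is a character of the harmonic algebra) with `c_y(φ) = 0`, the stuffle relation holds for `π_Y(φ)`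
  ITSELF off the corner: `π_Y(φ)(s) π_Y(φ)(t) = Σ_{u ∈ s ∗ t} π_Y(φ)(u)` for `s` admissible nonempty
  and `t` positive not beginning `1,1`. Proof: Furusho's correction `φ_corr ∈ R[[Y₁]]` has
  `c_{Y₁}(φ_corr) = −c_y(φ) = 0`, so `c_u(φ_*) = c_u(π_Y φ)` for every `u` not beginning `Y₁Y₁`
  (`seriesShuffleReg_apply_of_take_two`), and no index in `s ∗ t` begins `1,1`
  (`take_two_ne_of_mem_stuffle`) — this is the case of Ihara–Kaneko–Zagier 2006, Thm 2 that the engine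
  uses (its row names never begin `1,1`, `LinEDS.validName`);
* `evalZ_rowZ_of_gds` / registered stub `stub_rowZ_of_gds` — hence the integer EDS row of every valid
  name evaluates to `0` at every GROUP-LIKE double-shuffle solution with `c_y = 0` (shuffle half by
  group-likeness, harmonic half by the above) — no pentagon, no reducedness.

With E5′ the solution-agnostic steps E6–E9 of the chain give the double-shuffle leaf `LeafDS` from the
SAME landed block certificates (weights `14 … 17`: sibling files `…EdsDSLeafOfOddDet`, `…EdsDSWeight*`).

Sources: K. Ihara, M. Kaneko, D. Zagier, Compos. Math. 142 (2006), §2, Thm 2 and Conj. 1; G. Racinet,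
Publ. Math. IHÉS 95 (2002), Def. 3.1; H. Furusho, Ann. of Math. 174 (2011), §2.
-/

namespace Summit.KontsevichZagierPeriods.LinRedNormalForm.HoffmanSpanInKZ

open Literature.NumberTheory.Transcendental
open Summit.KontsevichZagierPeriods.FurushoPentagon.KernelModuloPeriodConjecture

/-! ## Furusho's correction in depth one -/

/-- `c_{Y₁}(φ_corr) = −c_y(φ)`: the exponential agrees with its logarithm on letters, and
`c_{Y₁}(corrLog φ) = ((-1)^1/1) c_{x⁰y}(φ)`. [cite: Furusho2011, §2] -/
theorem corr_apply_one {R : Type*} [CommRing R] [Algebra ℚ R] (φ : NCSeries Bool R) :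
    NCSeries.corr φ [1] = -φ [true] := by
  rw [NCSeries.corr]
  have hexp : NCSeries.exp (NCSeries.corrLog φ) [1] = NCSeries.corrLog φ [1] := by
    simp [NCSeries.exp, Finset.sum_range_succ]
  rw [hexp, show ([1] : List ℕ) = List.replicate 1 1 from rfl,
    NCSeries.corrLog_apply_replicate φ one_ne_zero]
  simp [MZV.binaryWord]

/-- **`φ_*` agrees with `π_Y(φ)` on every Y-word not beginning `Y₁Y₁`** when `c_y(φ) = 0`: in
`φ_* = φ_corr · π_Y(φ)` the correction `φ_corr ∈ R[[Y₁]]` contributes only through its constant term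
`1` and `c_{Y₁}(φ_corr) = −c_y(φ) = 0`. [cite: IharaKanekoZagier2006, Thm 2] -/
theorem seriesShuffleReg_apply_of_take_two {R : Type*} [CommRing R] [Algebra ℚ R]
    {φ : NCSeries Bool R} (h1 : φ [true] = 0) {u : List ℕ} (hu : u.take 2 ≠ [1, 1]) :
    NCSeries.seriesShuffleReg φ u = NCSeries.piY φ u := by
  rw [NCSeries.seriesShuffleReg, NCSeries.mul_apply,
    Finset.sum_eq_single_of_mem ([], u) (NCSeries.nil_self_mem_splits u)]
  · simp
  · rintro ⟨p, q⟩ hp hne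
    rw [NCSeries.mem_splits] at hp
    by_cases hp1 : ∃ i ∈ p, i ≠ 1
    · rw [NCSeries.corr_apply_eq_zero φ hp1, zero_mul]
    · push Not at hp1
      match p, hp1, hp with
      | [], _, hp =>
        simp only [List.nil_append] at hp
        subst hp
        exact absurd rfl hne
      | [a], hp1, hp =>
        have ha : a = 1 := hp1 a (by simp)
        subst ha
        show NCSeries.corr φ [1] * NCSeries.piY φ q = 0
        rw [corr_apply_one, h1, neg_zero, zero_mul]
      | a :: b :: p', hp1, hp =>
        have ha : a = 1 := hp1 a (by simp)
        have hb : b = 1 := hp1 b (by simp)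
        subst ha hb
        exact absurd (by rw [← hp]; rfl) hu

/-! ## No index of `s ∗ t` begins `1, 1` -/

/-- The first entry of an index in `(a s') ∗ (c t'')` is `a`, `c` or `a + c`. [cite: Hoffman1997, §2 (A3)] -/
theorem head?_of_mem_stuffle_cons_cons {a c : ℕ} {s' t'' v : List ℕ}
    (hv : v ∈ MZV.stuffle (a :: s') (c :: t'')) :
    v.head? = some a ∨ v.head? = some c ∨ v.head? = some (a + c) := by
  simp only [MZV.stuffle_cons_cons, List.mem_append, List.mem_map] at hv
  rcases hv with ⟨w, -, rfl⟩ | ⟨w, -, rfl⟩ | ⟨w, -, rfl⟩ <;> simp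

/-- **No index in `s ∗ t` begins `1, 1`** when `s` is admissible nonempty and `t` (positive) does not
begin `1, 1`: the first entry of a word of `s ∗ t` is `s₁ ≥ 2`, `s₁ + t₁ ≥ 3`, or `t₁`, and in the
last case the second entry is `s₁`, `t₂ ≠ 1`, or `s₁ + t₂`. [cite: Hoffman1997, §2 (A3)] -/
theorem take_two_ne_of_mem_stuffle {s t u : List ℕ} (hs : MZV.IsAdmissible s) (hs0 : s ≠ [])
    (ht2 : t.take 2 ≠ [1, 1]) (hu : u ∈ MZV.stuffle s t) : u.take 2 ≠ [1, 1] := by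
  obtain ⟨a, s', rfl⟩ := List.exists_cons_of_ne_nil hs0
  have ha : 2 ≤ a := hs.2 (List.cons_ne_nil _ _)
  rcases t with _ | ⟨b, t'⟩
  · simp only [MZV.stuffle_nil_right, List.mem_singleton] at hu
    subst hu
    simp only [List.take_succ_cons, ne_eq, List.cons.injEq, not_and]
    omega
  simp only [MZV.stuffle_cons_cons, List.mem_append, List.mem_map] at hu
  rcases hu with ⟨v, -, rfl⟩ | ⟨v, hv, rfl⟩ | ⟨v, -, rfl⟩
  · simp only [List.take_succ_cons, ne_eq, List.cons.injEq, not_and]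
    omega
  · simp only [List.take_succ_cons, ne_eq, List.cons.injEq, not_and]
    intro hb
    subst hb
    -- `t'` does not begin with `1`
    rcases t' with _ | ⟨c, t''⟩
    · simp only [MZV.stuffle_nil_right, List.mem_singleton] at hv
      subst hv
      simp only [List.take_succ_cons, List.take_zero, List.cons.injEq, and_true]
      omega
    · have hc : c ≠ 1 := by
        intro hc; subst hc; exact ht2 rfl
      rcases head?_of_mem_stuffle_cons_cons hv with h | h | h
      · cases v with
        | nil => simp at h
        | cons d v' => simp only [List.head?_cons, Option.some.injEq] at h; subst h
                       simp only [List.take_succ_cons, List.take_zero, List.cons.injEq, and_true]; omega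
      · cases v with
        | nil => simp at h
        | cons d v' => simp only [List.head?_cons, Option.some.injEq] at h; subst h
                       simp only [List.take_succ_cons, List.take_zero, List.cons.injEq, and_true]; exact hc
      · cases v with
        | nil => simp at h
        | cons d v' => simp only [List.head?_cons, Option.some.injEq] at h; subst h
                       simp only [List.take_succ_cons, List.take_zero, List.cons.injEq, and_true]; omega
  · simp only [List.take_succ_cons, ne_eq, List.cons.injEq, not_and]
    omega

/-! ## The stuffle relation for `π_Y(φ)` at a double-shuffle solution -/

/-- **IKZ's Theorem 2 for abstract double-shuffle solutions (the case the engine uses).** For `φ`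
satisfying Racinet's generalised double shuffle with `c_y(φ) = 0`, over a commutative `ℚ`-algebra:
`π_Y(φ)(s) π_Y(φ)(t) = Σ_{u ∈ s ∗ t} π_Y(φ)(u)` for `s` admissible nonempty and `t` with positive
entries not beginning `1, 1`. [cite: IharaKanekoZagier2006, Thm 2] -/
theorem piY_mul_piY_eq_sum_stuffle_of_gds {R : Type*} [CommRing R] [Algebra ℚ R]
    {φ : NCSeries Bool R} (hds : NCSeries.GeneralisedDoubleShuffle φ) (h1 : φ [true] = 0)
    {s t : List ℕ} (hs : MZV.IsAdmissible s) (hs0 : s ≠ []) (ht : ∀ i ∈ t, 1 ≤ i)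
    (ht2 : t.take 2 ≠ [1, 1]) :
    NCSeries.piY φ s * NCSeries.piY φ t = ((MZV.stuffle s t).map (NCSeries.piY φ)).sum := by
  have hs2 : s.take 2 ≠ [1, 1] := by
    obtain ⟨a, s', rfl⟩ := List.exists_cons_of_ne_nil hs0
    have ha : 2 ≤ a := hs.2 (List.cons_ne_nil _ _)
    simp only [List.take_succ_cons, ne_eq, List.cons.injEq, not_and]
    omega
  have h := hds s t hs.1 ht
  rw [seriesShuffleReg_apply_of_take_two h1 hs2, seriesShuffleReg_apply_of_take_two h1 ht2] at h
  rw [h]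
  exact congrArg List.sum (List.map_congr_left fun u hu =>
    seriesShuffleReg_apply_of_take_two h1 (take_two_ne_of_mem_stuffle hs hs0 ht2 hu))

/-! ## E5′: the rows vanish at every group-like double-shuffle solution -/

/-- The second factor of a valid row name does not begin `1, 1`. [folklore] -/
theorem take_two_ne_of_validName {k : ℕ} {ν : List ℕ × List ℕ} (h : LinEDS.validName k ν = true) :
    ν.2.take 2 ≠ [1, 1] := by
  obtain ⟨s, t⟩ := ν
  match s, t, h with
  | [], _, h => exact absurd h (by simp [LinEDS.validName])
  | _ :: _, [], h => exact absurd h (by simp [LinEDS.validName])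
  | a :: s, b :: t, h =>
    simp only [LinEDS.validName, Bool.and_eq_true, decide_eq_true_eq, List.all_eq_true,
      Bool.not_eq_true', Bool.and_eq_false_imp, beq_iff_eq] at h
    obtain ⟨⟨-, hbt⟩, -⟩ := h
    show (b :: t).take 2 ≠ [1, 1]
    intro h11
    cases t with
    | nil => simp at h11
    | cons c t' =>
      simp only [List.take_succ_cons, List.take_zero, List.cons.injEq, and_true] at h11
      obtain ⟨rfl, rfl⟩ := h11
      exact absurd (hbt rfl) (by simp)

/-- **E5′ — the integer EDS row of a valid name vanishes at every group-like double-shuffle solution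
with `c_y = 0`** over a commutative `ℚ`-algebra: the shuffle half is `c_{bw s} c_{bw t}` by
group-likeness, the harmonic half is `Σ_{u ∈ s ∗ t} π_Y(φ)(u) = π_Y(φ)(s) π_Y(φ)(t)` by
`piY_mul_piY_eq_sum_stuffle_of_gds`. [cite: IharaKanekoZagier2006, Thm 2] -/
theorem evalZ_rowZ_of_gds {R : Type*} [CommRing R] [Algebra ℚ R] {φ : NCSeries Bool R}
    (hg : NCSeries.IsGroupLike φ) (hds : NCSeries.GeneralisedDoubleShuffle φ) (h1 : φ [true] = 0)
    {k : ℕ} {ν : List ℕ × List ℕ} (hν : LinEDS.validName k ν = true) :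
    LinEDS.evalZ φ (LinEDS.rowZ ν) = 0 := by
  obtain ⟨hs, hs0, ht, -⟩ := evalE5_validName hν
  have ht2 := take_two_ne_of_validName hν
  rw [LinEDS.rowZ, evalE5_evalZ_sub, evalE5_evalZ_zsmul, evalE5_evalZ_stuffle_half φ hs.1 ht,
    evalE5_evalZ_shuffle_half hg, ← piY_mul_piY_eq_sum_stuffle_of_gds hds h1 hs hs0 ht ht2,
    NCSeries.piY_apply_of_forall_pos φ hs.1, NCSeries.piY_apply_of_forall_pos φ ht,
    evalE5_neg_one_pow_zsmul, pow_add]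
  ring

/-- **Registered stub `stub_rowZ_of_gds`** (line `eds-ds`, E5′): the rows of the linearised EDS system
vanish at every group-like double-shuffle solution with `c_y = 0`, over every commutative
`ℚ`-algebra. [cite: IharaKanekoZagier2006, Thm 2] -/
theorem stub_rowZ_of_gds :
    ∀ (R : Type) [CommRing R] [Algebra ℚ R] (φ : NCSeries Bool R), NCSeries.IsGroupLike φ →
      NCSeries.GeneralisedDoubleShuffle φ → φ [true] = 0 →
        ∀ (k : ℕ) (ν : List ℕ × List ℕ), LinEDS.validName k ν = true →
          LinEDS.evalZ φ (LinEDS.rowZ ν) = 0 :=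
  fun _ _ _ _ hg hds h1 _ _ hν => evalZ_rowZ_of_gds hg hds h1 hν

end Summit.KontsevichZagierPeriods.LinRedNormalForm.HoffmanSpanInKZ
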